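import Mathlib

/-!
# `SeaFactorisationBridge` (crux stmt-QuantumFields-13880) — negative-side support: `∀ W ∃ φ` versus
# `∃ reg ∀ m` — per-parameter subsequences do not assemble into one scheme

Standing-disprover extraction (cdisprove cycle 2).  Definition-free.  The Yang–Mills input of the bridge,
`RobustYangMills`, concludes for each admissible perturbation `W` the existence of a `W`-DEPENDENT
subsequence `φ` along which lattice Schwinger functions converge (to a possibly `φ`-dependent `T`); the
bridge's conclusion fixes ONE regularisation `reg` before the mass tuple `m` and demands FULL-sequence
convergence `IsQCDAlong (reg.scheme m z shift) T` for every real `m` (each `m` feeding a different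
effective `W_m`).  The two lemmas are the abstract content of that gap:

* `subseq_tendsto_not_tendsto` — subsequential convergence is not convergence;
* `no_common_subsequence` — a `{0,1}`-valued family over uncountably many parameters, each member with
  convergent subsequences along every subsequence, admits NO common subsequence along which all members
  converge.

So a proof of the bridge must add uniqueness of the continuum limit in the cone (universality, not in
`RobustYangMills`) or equicontinuity in `m` uniformly in `k` plus a diagonal extraction — bridge-internal
either way.
-/

namespace Summit.QuantumFields.QCD.Theorems.SeaFactorisationBridge.Negative

open Filter Topology

/-- **Subsequential convergence is not convergence**: `k ↦ k mod 2` converges along the even numbers and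
does not converge.  (`RobustYangMills` gives the former along a `W`-dependent `φ`; `IsQCDAlong` wants the
latter.) [folklore] -/
theorem subseq_tendsto_not_tendsto :
    ∃ x : ℕ → ℝ, (∃ φ : ℕ → ℕ, StrictMono φ ∧ Tendsto (x ∘ φ) atTop (𝓝 0)) ∧
      ¬ ∃ c, Tendsto x atTop (𝓝 c) := by
  refine ⟨fun k => ((k % 2 : ℕ) : ℝ), ⟨fun j => 2 * j, fun a b h => show 2 * a < 2 * b by omega, ?_⟩, ?_⟩
  · refine tendsto_const_nhds.congr fun j => ?_
    simp [Function.comp]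
  · rintro ⟨c, hc⟩
    have h0 : Tendsto (fun j : ℕ => ((2 * j % 2 : ℕ) : ℝ)) atTop (𝓝 c) :=
      hc.comp (StrictMono.tendsto_atTop (fun a b h => by omega))
    have h1 : Tendsto (fun j : ℕ => (((2 * j + 1) % 2 : ℕ) : ℝ)) atTop (𝓝 c) :=
      hc.comp (StrictMono.tendsto_atTop (fun a b h => by omega))
    have e0 : (fun j : ℕ => ((2 * j % 2 : ℕ) : ℝ)) = fun _ => 0 := by funext j; simp
    have e1 : (fun j : ℕ => (((2 * j + 1) % 2 : ℕ) : ℝ)) = fun _ => 1 := by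
      funext j; simp [Nat.add_mod]
    rw [e0] at h0
    rw [e1] at h1
    have hc0 : c = 0 := (tendsto_nhds_unique tendsto_const_nhds h0).symm ▸ rfl
    have hc1 : c = 1 := (tendsto_nhds_unique tendsto_const_nhds h1).symm ▸ rfl
    linarith

/-- **No common subsequence.** A `{0,1}`-valued family `x p` indexed by the uncountably many
`p : ℕ → Bool` (standing for the mass tuples `m`, each with its own effective `W_m`): every member has a
convergent subsequence along every subsequence (Bolzano–Weierstrass — what a compactness-type hypothesis
delivers parameter by parameter), yet for EVERY strictly monotone `φ` some member fails to converge
along `φ` (take `p` = the indicator of the even-indexed values of `φ`).  So "for each `m` a good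
subsequence" never yields "one `reg` good for all `m`" without uniqueness of the limits or continuity in
the parameter. [folklore] -/
theorem no_common_subsequence :
    ∃ x : (ℕ → Bool) → ℕ → ℝ, (∀ p k, x p k = 0 ∨ x p k = 1) ∧
      (∀ p, ∀ φ : ℕ → ℕ, StrictMono φ → ∃ ψ : ℕ → ℕ, StrictMono ψ ∧
        ∃ c, Tendsto (fun k => x p (φ (ψ k))) atTop (𝓝 c)) ∧
      ∀ φ : ℕ → ℕ, StrictMono φ → ∃ p, ¬ ∃ c, Tendsto (fun k => x p (φ k)) atTop (𝓝 c) := by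
  classical
  refine ⟨fun p k => if p k then 1 else 0, fun p k => by by_cases h : p k <;> simp [h], ?_, ?_⟩
  · intro p φ _hφ
    have hs : Bornology.IsBounded ({0, 1} : Set ℝ) := (Set.toFinite _).isBounded
    have hx : ∀ k, (fun k => if p (φ k) then (1 : ℝ) else 0) k ∈ ({0, 1} : Set ℝ) := fun k => by
      by_cases h : p (φ k) <;> simp [h]
    obtain ⟨a, -, ψ, hψ, hlim⟩ := tendsto_subseq_of_bounded hs hx
    exact ⟨ψ, hψ, a, hlim⟩
  · intro φ hφ
    let p : ℕ → Bool := fun n => decide (∃ j, n = φ (2 * j))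
    refine ⟨p, ?_⟩
    rintro ⟨c, hc⟩
    have h0 : Tendsto (fun j : ℕ => if p (φ (2 * j)) then (1 : ℝ) else 0) atTop (𝓝 c) :=
      hc.comp (StrictMono.tendsto_atTop (fun a b h => by omega))
    have h1 : Tendsto (fun j : ℕ => if p (φ (2 * j + 1)) then (1 : ℝ) else 0) atTop (𝓝 c) :=
      hc.comp (StrictMono.tendsto_atTop (fun a b h => by omega))
    have e0 : (fun j : ℕ => if p (φ (2 * j)) then (1 : ℝ) else 0) = fun _ => 1 := by
      funext j
      have : p (φ (2 * j)) = true := by simp only [p, decide_eq_true_eq]; exact ⟨j, rfl⟩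
      simp [this]
    have e1 : (fun j : ℕ => if p (φ (2 * j + 1)) then (1 : ℝ) else 0) = fun _ => 0 := by
      funext j
      have : p (φ (2 * j + 1)) = false := by
        simp only [p, decide_eq_false_iff_not, not_exists]
        intro i h
        have := hφ.injective h
        omega
      simp [this]
    rw [e0] at h0
    rw [e1] at h1
    have hc0 : c = 1 := tendsto_nhds_unique h0 tendsto_const_nhds ▸ rfl
    have hc1 : c = 0 := tendsto_nhds_unique h1 tendsto_const_nhds ▸ rfl
    linarith

end Summit.QuantumFields.QCD.Theorems.SeaFactorisationBridge.Negative
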